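import Summits.HodgeConjecture.CorCM.HodgeLieAlgebraReductive
import Literature.AlgebraicGeometry.Motives.HodgeLieCentralRadical
import Literature.AlgebraicGeometry.Motives.MumfordTateLieAlgebraCentralRadical
import HarnessLib

/-!
# The rung `dim MT(H¹X) = 6` of the Mumford–Tate ladder for `X` not of CM type: `Lie Hg(H¹X) = 𝔷 ⊕ 𝔰` with `dim 𝔷 = 2`
# and `𝔰 = [Lie Hg, Lie Hg]` simple of dimension `3`; the shape table for `dim MT ≤ 9`

COR-CM (cell `pub-hodgecm2`, seat `b27` gen 36, count-neutral lane MT-REDUCTIVE; theorems only, no definition, no named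
fact; UNCONDITIONAL — nothing here uses or asserts HC_CM).  Notation as in `CorCM/HodgeLieAlgebraReductive`:
`𝔥 = Lie Hg(H¹X)`, `𝔷 = 𝔥 ∩ End_Hdg(H¹X)` (the centre), `𝔡 = [𝔥, 𝔥]` (semisimple), `t = dim MT(H¹X) = dim 𝔷 + dim 𝔡 + 1`,
`dim 𝔡 ∉ {1, 2, 4, 5, 7}`, and `X` is of CM type iff `𝔡 = 0`.  Read rung by rung (all for `X` NOT of CM type, `0 < dim X`):

* `center_derived_of_mtRank_hodge_one_eq_four` — `t = 4 ⟹ dim 𝔷 = 0, dim 𝔡 = 3` (gen 30's rung: `Hg` is a form of `SL₂`);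
* `center_derived_of_mtRank_hodge_one_eq_five` — `t = 5 ⟹ dim 𝔷 = 1, dim 𝔡 = 3` (gen 33's rung `SL₂ × U(1)`, now read
  structurally: a one-dimensional centre and a rank-one semisimple part);
* **`center_derived_of_mtRank_hodge_one_eq_six`** — `t = 6 ⟹ dim 𝔷 = 2, dim 𝔡 = 3`: THE NEW RUNG — the semisimple part of
  `Lie Hg` is still three-dimensional (a `ℚ`-form of `𝔰𝔩₂`) and the centre is a two-dimensional space of `ψ`-skew central
  Hodge endomorphisms; in particular **`not_hasNoTypeIVFactor_of_mtRank_hodge_one_eq_six`**: such an `X` has a simple factor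
  of Albert type IV (`𝔷 ≠ 0`, Moonen–Zarhin §1), and `not_hasNoTypeIVFactor_of_mtRank_hodge_one_eq_five` likewise;
* `center_derived_of_mtRank_hodge_one_eq_seven` — `t = 7 ⟹ (dim 𝔷, dim 𝔡) = (3, 3)` or `(0, 6)`;
  `center_derived_of_mtRank_hodge_one_eq_eight` — `t = 8 ⟹ (4, 3)` or `(1, 6)`;
  `center_derived_of_mtRank_hodge_one_eq_nine` — `t = 9 ⟹ (5, 3)`, `(2, 6)` or `(0, 8)`;
* `four_add_finrank_center_le_mtRank_hodge_one` — in general `t ≥ dim 𝔷 + 4` for non-CM `X`;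
* **`hasCentralRadical_of_eq_hodgeLie_hodge_one`** — «`Lie Hg(H¹X)` is reductive» in Mathlib's exact spelling: for every Lie
  subalgebra `𝔏 ≤ 𝔤𝔩(H¹X)` (commutator bracket) with carrier `Lie Hg(H¹X)`, `LieAlgebra.HasCentralRadical ℚ 𝔏` (`rad 𝔏 = Z(𝔏)`,
  `Motives/HodgeLieCentralRadical`), and `radical_le_center_hodge_one` (its radical consists of `ψ`-skew central Hodge endomorphisms);
* **`hasCentralRadical_of_eq_mumfordTateLieAlgebra_hodge_one`** — DELIGNE I 3.6 for `H¹X` in Lie form: the Mumford–Tate Lie algebra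
  `𝔪𝔱(H¹X)` (`= Lie Hg ⊕ ℚ·id`) has central radical; `mumfordTateLieAlgebra_hodge_one_derived_eq` (`[𝔪𝔱, 𝔪𝔱] = [Lie Hg, Lie Hg]`).

## References
* [MoonenZarhin1999LowDim] B. Moonen, Yu. Zarhin, Math. Ann. 315 (1999), §1–§2.
* [Deligne1982HodgeCycles] P. Deligne, LNM 900 (1982), I Prop. 3.6.
* [Humphreys1972] J. E. Humphreys, GTM 9, §8.4, §19.1.
-/

noncomputable section

open CategoryTheory CategoryTheory.Limits Module
open scoped BigOperators

namespace Summit.HodgeConjecture.CorCM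

open Literature.AlgebraicGeometry.Motives
open Literature.AlgebraicGeometry.Motives.AbelianVariety
open Literature.AlgebraicGeometry.Motives.HodgeStructure
open Literature.AlgebraicGeometry.HodgeTheory
open Literature.AlgebraicGeometry.Milne1999 (IsOfCMType)

variable [HodgeTensorFacts.{0, 0}] {X : AbelianVariety ℂ} {n : ℕ}

/-- **The shape constraints** for `X` not of CM type (`0 < dim X`): with `z = dim 𝔷`, `d = dim 𝔡`, `t = dim MT(H¹X)`:
`t = z + d + 1`, `d ≠ 0`, `d ∉ {1, 2, 4, 5, 7}`. Packaged for the rungs below. [cite: MoonenZarhin1999LowDim, §1–§2]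
[cite: Humphreys1972, §8.4] -/
theorem mtRank_hodge_one_shape (hX : IsSmoothProjective n X.X) (h0 : 0 < X.dim) (hcm : ¬ IsOfCMType X) :
    haveI := BettiUniverse.finite hX 1
    (BettiUniverse.hodge exists_isReal_hodgeModel_holds hX 1).mtRank =
      Module.finrank ℚ ↥((BettiUniverse.hodge exists_isReal_hodgeModel_holds hX 1).hodgeLie ⊓
          Subalgebra.toSubmodule (BettiUniverse.hodge exists_isReal_hodgeModel_holds hX 1).endAlg) +
        Module.finrank ℚ ↥(Submodule.span ℚ {B | ∃ X' ∈ (BettiUniverse.hodge exists_isReal_hodgeModel_holds hX 1).hodgeLie,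
          ∃ Y ∈ (BettiUniverse.hodge exists_isReal_hodgeModel_holds hX 1).hodgeLie, X' * Y - Y * X' = B}) + 1 ∧
    3 ≤ Module.finrank ℚ ↥(Submodule.span ℚ {B | ∃ X' ∈ (BettiUniverse.hodge exists_isReal_hodgeModel_holds hX 1).hodgeLie,
        ∃ Y ∈ (BettiUniverse.hodge exists_isReal_hodgeModel_holds hX 1).hodgeLie, X' * Y - Y * X' = B}) ∧
    Module.finrank ℚ ↥(Submodule.span ℚ {B | ∃ X' ∈ (BettiUniverse.hodge exists_isReal_hodgeModel_holds hX 1).hodgeLie,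
        ∃ Y ∈ (BettiUniverse.hodge exists_isReal_hodgeModel_holds hX 1).hodgeLie, X' * Y - Y * X' = B}) ≠ 4 ∧
    Module.finrank ℚ ↥(Submodule.span ℚ {B | ∃ X' ∈ (BettiUniverse.hodge exists_isReal_hodgeModel_holds hX 1).hodgeLie,
        ∃ Y ∈ (BettiUniverse.hodge exists_isReal_hodgeModel_holds hX 1).hodgeLie, X' * Y - Y * X' = B}) ≠ 5 ∧
    Module.finrank ℚ ↥(Submodule.span ℚ {B | ∃ X' ∈ (BettiUniverse.hodge exists_isReal_hodgeModel_holds hX 1).hodgeLie,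
        ∃ Y ∈ (BettiUniverse.hodge exists_isReal_hodgeModel_holds hX 1).hodgeLie, X' * Y - Y * X' = B}) ≠ 7 := by
  have h1 := mtRank_hodge_one_eq_center_add_derived_add_one hX h0
  have h2 := finrank_hodgeLie_hodge_one_derived_ne hX
  have h3 := three_le_finrank_hodgeLie_hodge_one_derived hX hcm
  exact ⟨h1, h3.1, h2.2.2.1, h2.2.2.2.1, h2.2.2.2.2⟩

/-- **`t ≥ dim 𝔷 + 4` for `X` not of CM type** (the semisimple part has dimension `≥ 3`). [cite: MoonenZarhin1999LowDim, §2] -/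
theorem four_add_finrank_center_le_mtRank_hodge_one (hX : IsSmoothProjective n X.X) (h0 : 0 < X.dim)
    (hcm : ¬ IsOfCMType X) :
    haveI := BettiUniverse.finite hX 1
    Module.finrank ℚ ↥((BettiUniverse.hodge exists_isReal_hodgeModel_holds hX 1).hodgeLie ⊓
        Subalgebra.toSubmodule (BettiUniverse.hodge exists_isReal_hodgeModel_holds hX 1).endAlg) + 4 ≤
      (BettiUniverse.hodge exists_isReal_hodgeModel_holds hX 1).mtRank := by
  obtain ⟨h1, h3, -, -, -⟩ := mtRank_hodge_one_shape hX h0 hcm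
  omega

/-- **Rung `t = 4` (non-CM): `dim 𝔷 = 0`, `dim 𝔡 = 3`** — `Lie Hg` is semisimple of dimension `3`.
[cite: MoonenZarhin1999LowDim, §2] -/
theorem center_derived_of_mtRank_hodge_one_eq_four (hX : IsSmoothProjective n X.X) (h0 : 0 < X.dim)
    (hcm : ¬ IsOfCMType X)
    (h4 : haveI := BettiUniverse.finite hX 1
      (BettiUniverse.hodge exists_isReal_hodgeModel_holds hX 1).mtRank = 4) :
    haveI := BettiUniverse.finite hX 1
    Module.finrank ℚ ↥((BettiUniverse.hodge exists_isReal_hodgeModel_holds hX 1).hodgeLie ⊓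
        Subalgebra.toSubmodule (BettiUniverse.hodge exists_isReal_hodgeModel_holds hX 1).endAlg) = 0 ∧
      Module.finrank ℚ ↥(Submodule.span ℚ {B | ∃ X' ∈ (BettiUniverse.hodge exists_isReal_hodgeModel_holds hX 1).hodgeLie,
        ∃ Y ∈ (BettiUniverse.hodge exists_isReal_hodgeModel_holds hX 1).hodgeLie, X' * Y - Y * X' = B}) = 3 := by
  obtain ⟨h1, h3, -, -, -⟩ := mtRank_hodge_one_shape hX h0 hcm
  omega

/-- **Rung `t = 5` (non-CM): `dim 𝔷 = 1`, `dim 𝔡 = 3`** — Moonen–Zarhin's `Hg = SL₂ · U(1)` shape read on the Lie algebra: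
one-dimensional centre, three-dimensional semisimple part (gen 33 proved this ad hoc; here from reductivity).
[cite: MoonenZarhin1999LowDim, §2] -/
theorem center_derived_of_mtRank_hodge_one_eq_five (hX : IsSmoothProjective n X.X) (h0 : 0 < X.dim)
    (hcm : ¬ IsOfCMType X)
    (h5 : haveI := BettiUniverse.finite hX 1
      (BettiUniverse.hodge exists_isReal_hodgeModel_holds hX 1).mtRank = 5) :
    haveI := BettiUniverse.finite hX 1
    Module.finrank ℚ ↥((BettiUniverse.hodge exists_isReal_hodgeModel_holds hX 1).hodgeLie ⊓
        Subalgebra.toSubmodule (BettiUniverse.hodge exists_isReal_hodgeModel_holds hX 1).endAlg) = 1 ∧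
      Module.finrank ℚ ↥(Submodule.span ℚ {B | ∃ X' ∈ (BettiUniverse.hodge exists_isReal_hodgeModel_holds hX 1).hodgeLie,
        ∃ Y ∈ (BettiUniverse.hodge exists_isReal_hodgeModel_holds hX 1).hodgeLie, X' * Y - Y * X' = B}) = 3 := by
  obtain ⟨h1, h3, h4, -, -⟩ := mtRank_hodge_one_shape hX h0 hcm
  omega

/-- **Rung `t = 6` (non-CM): `dim 𝔷 = 2`, `dim 𝔡 = 3`** — for a complex abelian variety `X` NOT of CM type with
`dim MT(H¹X) = 6`, the Lie algebra of its Hodge group is the direct sum of a TWO-dimensional centre of `ψ`-skew central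
Hodge endomorphisms and a THREE-dimensional simple Lie algebra `[Lie Hg, Lie Hg]` (a `ℚ`-form of `𝔰𝔩₂`): the semisimple
part cannot have dimension `4` or `5`. [cite: MoonenZarhin1999LowDim, §1–§2] [cite: Humphreys1972, §8.4] -/
theorem center_derived_of_mtRank_hodge_one_eq_six (hX : IsSmoothProjective n X.X) (h0 : 0 < X.dim)
    (hcm : ¬ IsOfCMType X)
    (h6 : haveI := BettiUniverse.finite hX 1
      (BettiUniverse.hodge exists_isReal_hodgeModel_holds hX 1).mtRank = 6) :
    haveI := BettiUniverse.finite hX 1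
    Module.finrank ℚ ↥((BettiUniverse.hodge exists_isReal_hodgeModel_holds hX 1).hodgeLie ⊓
        Subalgebra.toSubmodule (BettiUniverse.hodge exists_isReal_hodgeModel_holds hX 1).endAlg) = 2 ∧
      Module.finrank ℚ ↥(Submodule.span ℚ {B | ∃ X' ∈ (BettiUniverse.hodge exists_isReal_hodgeModel_holds hX 1).hodgeLie,
        ∃ Y ∈ (BettiUniverse.hodge exists_isReal_hodgeModel_holds hX 1).hodgeLie, X' * Y - Y * X' = B}) = 3 := by
  obtain ⟨h1, h3, h4, h5, -⟩ := mtRank_hodge_one_shape hX h0 hcm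
  omega

/-- **Rung `t = 6` (non-CM): `X` has a simple factor of Albert type IV** — the centre of `Lie Hg(H¹X)` is non-zero, while it
vanishes when the centre of `End⁰(X)` is totally real (`hodgeLie_hodge_one_inf_endAlg_eq_bot_of_hasNoTypeIVFactor`).
[cite: MoonenZarhin1999LowDim, §1] -/
theorem not_hasNoTypeIVFactor_of_mtRank_hodge_one_eq_six (hX : IsSmoothProjective n X.X) (h0 : 0 < X.dim)
    (hcm : ¬ IsOfCMType X)
    (h6 : haveI := BettiUniverse.finite hX 1
      (BettiUniverse.hodge exists_isReal_hodgeModel_holds hX 1).mtRank = 6) :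
    ¬ HasNoTypeIVFactor X := by
  intro hA4
  have h := (center_derived_of_mtRank_hodge_one_eq_six hX h0 hcm h6).1
  rw [hodgeLie_hodge_one_inf_endAlg_eq_bot_of_hasNoTypeIVFactor hX hA4, finrank_bot] at h
  exact absurd h (by norm_num)

/-- **Rung `t = 5` (non-CM): `X` has a simple factor of Albert type IV** (the centre of `Lie Hg` is one-dimensional; in gen
33's classification this is the CM elliptic curve `Bⱼ`). [cite: MoonenZarhin1999LowDim, §1] -/
theorem not_hasNoTypeIVFactor_of_mtRank_hodge_one_eq_five (hX : IsSmoothProjective n X.X) (h0 : 0 < X.dim)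
    (hcm : ¬ IsOfCMType X)
    (h5 : haveI := BettiUniverse.finite hX 1
      (BettiUniverse.hodge exists_isReal_hodgeModel_holds hX 1).mtRank = 5) :
    ¬ HasNoTypeIVFactor X := by
  intro hA4
  have h := (center_derived_of_mtRank_hodge_one_eq_five hX h0 hcm h5).1
  rw [hodgeLie_hodge_one_inf_endAlg_eq_bot_of_hasNoTypeIVFactor hX hA4, finrank_bot] at h
  exact absurd h (by norm_num)

/-- **Rung `t = 7` (non-CM): `(dim 𝔷, dim 𝔡) = (3, 3)` or `(0, 6)`.** [cite: MoonenZarhin1999LowDim, §1–§2]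
[cite: Humphreys1972, §8.4] -/
theorem center_derived_of_mtRank_hodge_one_eq_seven (hX : IsSmoothProjective n X.X) (h0 : 0 < X.dim)
    (hcm : ¬ IsOfCMType X)
    (h7 : haveI := BettiUniverse.finite hX 1
      (BettiUniverse.hodge exists_isReal_hodgeModel_holds hX 1).mtRank = 7) :
    haveI := BettiUniverse.finite hX 1
    (Module.finrank ℚ ↥((BettiUniverse.hodge exists_isReal_hodgeModel_holds hX 1).hodgeLie ⊓
        Subalgebra.toSubmodule (BettiUniverse.hodge exists_isReal_hodgeModel_holds hX 1).endAlg) = 3 ∧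
      Module.finrank ℚ ↥(Submodule.span ℚ {B | ∃ X' ∈ (BettiUniverse.hodge exists_isReal_hodgeModel_holds hX 1).hodgeLie,
        ∃ Y ∈ (BettiUniverse.hodge exists_isReal_hodgeModel_holds hX 1).hodgeLie, X' * Y - Y * X' = B}) = 3) ∨
    (Module.finrank ℚ ↥((BettiUniverse.hodge exists_isReal_hodgeModel_holds hX 1).hodgeLie ⊓
        Subalgebra.toSubmodule (BettiUniverse.hodge exists_isReal_hodgeModel_holds hX 1).endAlg) = 0 ∧
      Module.finrank ℚ ↥(Submodule.span ℚ {B | ∃ X' ∈ (BettiUniverse.hodge exists_isReal_hodgeModel_holds hX 1).hodgeLie,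
        ∃ Y ∈ (BettiUniverse.hodge exists_isReal_hodgeModel_holds hX 1).hodgeLie, X' * Y - Y * X' = B}) = 6) := by
  obtain ⟨h1, h3, h4, h5, -⟩ := mtRank_hodge_one_shape hX h0 hcm
  omega

/-- **Rung `t = 8` (non-CM): `(dim 𝔷, dim 𝔡) = (4, 3)` or `(1, 6)`.** [cite: MoonenZarhin1999LowDim, §1–§2]
[cite: Humphreys1972, §8.4] -/
theorem center_derived_of_mtRank_hodge_one_eq_eight (hX : IsSmoothProjective n X.X) (h0 : 0 < X.dim)
    (hcm : ¬ IsOfCMType X)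
    (h8 : haveI := BettiUniverse.finite hX 1
      (BettiUniverse.hodge exists_isReal_hodgeModel_holds hX 1).mtRank = 8) :
    haveI := BettiUniverse.finite hX 1
    (Module.finrank ℚ ↥((BettiUniverse.hodge exists_isReal_hodgeModel_holds hX 1).hodgeLie ⊓
        Subalgebra.toSubmodule (BettiUniverse.hodge exists_isReal_hodgeModel_holds hX 1).endAlg) = 4 ∧
      Module.finrank ℚ ↥(Submodule.span ℚ {B | ∃ X' ∈ (BettiUniverse.hodge exists_isReal_hodgeModel_holds hX 1).hodgeLie,
        ∃ Y ∈ (BettiUniverse.hodge exists_isReal_hodgeModel_holds hX 1).hodgeLie, X' * Y - Y * X' = B}) = 3) ∨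
    (Module.finrank ℚ ↥((BettiUniverse.hodge exists_isReal_hodgeModel_holds hX 1).hodgeLie ⊓
        Subalgebra.toSubmodule (BettiUniverse.hodge exists_isReal_hodgeModel_holds hX 1).endAlg) = 1 ∧
      Module.finrank ℚ ↥(Submodule.span ℚ {B | ∃ X' ∈ (BettiUniverse.hodge exists_isReal_hodgeModel_holds hX 1).hodgeLie,
        ∃ Y ∈ (BettiUniverse.hodge exists_isReal_hodgeModel_holds hX 1).hodgeLie, X' * Y - Y * X' = B}) = 6) := by
  obtain ⟨h1, h3, h4, h5, h7⟩ := mtRank_hodge_one_shape hX h0 hcm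
  omega

/-- **Rung `t = 9` (non-CM): `(dim 𝔷, dim 𝔡) = (5, 3)`, `(2, 6)` or `(0, 8)`.** [cite: MoonenZarhin1999LowDim, §1–§2]
[cite: Humphreys1972, §8.4] -/
theorem center_derived_of_mtRank_hodge_one_eq_nine (hX : IsSmoothProjective n X.X) (h0 : 0 < X.dim)
    (hcm : ¬ IsOfCMType X)
    (h9 : haveI := BettiUniverse.finite hX 1
      (BettiUniverse.hodge exists_isReal_hodgeModel_holds hX 1).mtRank = 9) :
    haveI := BettiUniverse.finite hX 1
    (Module.finrank ℚ ↥((BettiUniverse.hodge exists_isReal_hodgeModel_holds hX 1).hodgeLie ⊓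
        Subalgebra.toSubmodule (BettiUniverse.hodge exists_isReal_hodgeModel_holds hX 1).endAlg) = 5 ∧
      Module.finrank ℚ ↥(Submodule.span ℚ {B | ∃ X' ∈ (BettiUniverse.hodge exists_isReal_hodgeModel_holds hX 1).hodgeLie,
        ∃ Y ∈ (BettiUniverse.hodge exists_isReal_hodgeModel_holds hX 1).hodgeLie, X' * Y - Y * X' = B}) = 3) ∨
    (Module.finrank ℚ ↥((BettiUniverse.hodge exists_isReal_hodgeModel_holds hX 1).hodgeLie ⊓
        Subalgebra.toSubmodule (BettiUniverse.hodge exists_isReal_hodgeModel_holds hX 1).endAlg) = 2 ∧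
      Module.finrank ℚ ↥(Submodule.span ℚ {B | ∃ X' ∈ (BettiUniverse.hodge exists_isReal_hodgeModel_holds hX 1).hodgeLie,
        ∃ Y ∈ (BettiUniverse.hodge exists_isReal_hodgeModel_holds hX 1).hodgeLie, X' * Y - Y * X' = B}) = 6) ∨
    (Module.finrank ℚ ↥((BettiUniverse.hodge exists_isReal_hodgeModel_holds hX 1).hodgeLie ⊓
        Subalgebra.toSubmodule (BettiUniverse.hodge exists_isReal_hodgeModel_holds hX 1).endAlg) = 0 ∧
      Module.finrank ℚ ↥(Submodule.span ℚ {B | ∃ X' ∈ (BettiUniverse.hodge exists_isReal_hodgeModel_holds hX 1).hodgeLie,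
        ∃ Y ∈ (BettiUniverse.hodge exists_isReal_hodgeModel_holds hX 1).hodgeLie, X' * Y - Y * X' = B}) = 8) := by
  obtain ⟨h1, h3, h4, h5, h7⟩ := mtRank_hodge_one_shape hX h0 hcm
  omega

/-! ### «`Lie Hg(H¹X)` is reductive» in Mathlib's spelling -/

/-- **`Lie Hg(H¹X)` has central radical over `ℚ`** (`LieAlgebra.HasCentralRadical`, Mathlib's «reductive») — for every complex
abelian variety `X` and every Lie subalgebra `𝔏 ≤ 𝔤𝔩(H¹X)` (commutator bracket `LieRing.ofAssociativeRing`, supplied by a `letI`)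
with carrier `Lie Hg(H¹X)`: `rad 𝔏 = Z(𝔏)`. Deligne I 3.6 «`MT(V,h)` est réductif»; Moonen–Zarhin §1 «`Hg(X)` is a connected
reductive algebraic group». [cite: Deligne1982HodgeCycles, I §3 Prop. 3.6] [cite: MoonenZarhin1999LowDim, §1] -/
theorem hasCentralRadical_of_eq_hodgeLie_hodge_one (hX : IsSmoothProjective n X.X) :
    haveI := BettiUniverse.finite hX 1
    letI : LieRing (Module.End ℚ (bettiCohomology X.X 1)) := LieRing.ofAssociativeRing
    ∀ 𝔏 : LieSubalgebra ℚ (Module.End ℚ (bettiCohomology X.X 1)),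
      𝔏.toSubmodule = (BettiUniverse.hodge exists_isReal_hodgeModel_holds hX 1).hodgeLie →
      LieAlgebra.HasCentralRadical ℚ 𝔏 := by
  haveI := BettiUniverse.finite hX 1
  letI : LieRing (Module.End ℚ (bettiCohomology X.X 1)) := LieRing.ofAssociativeRing
  intro 𝔏 h𝔏
  obtain ⟨ψ⟩ := BettiUniverse.hodge_isPolarizable exists_isReal_hodgeModel_holds hX 1
  exact hasCentralRadical_of_eq_hodgeLie _ (by simp) (BettiUniverse.hodge_isEffective _ hX 1) ψ 𝔏 h𝔏

/-- **The radical of `Lie Hg(H¹X)` is `Lie Hg ∩ End_Hdg(H¹X)`**, read elementwise: every element of `rad 𝔏` is a (central,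
`ψ`-skew) Hodge endomorphism lying in `Lie Hg`. [cite: MoonenZarhin1999LowDim, §1] [cite: Deligne1982HodgeCycles, I §3 Prop. 3.6] -/
theorem radical_le_center_hodge_one (hX : IsSmoothProjective n X.X) :
    haveI := BettiUniverse.finite hX 1
    letI : LieRing (Module.End ℚ (bettiCohomology X.X 1)) := LieRing.ofAssociativeRing
    ∀ 𝔏 : LieSubalgebra ℚ (Module.End ℚ (bettiCohomology X.X 1)),
      𝔏.toSubmodule = (BettiUniverse.hodge exists_isReal_hodgeModel_holds hX 1).hodgeLie →
      ∀ r : 𝔏, r ∈ LieAlgebra.radical ℚ 𝔏 →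
        (r : Module.End ℚ (bettiCohomology X.X 1)) ∈ (BettiUniverse.hodge exists_isReal_hodgeModel_holds hX 1).hodgeLie ⊓
          Subalgebra.toSubmodule (BettiUniverse.hodge exists_isReal_hodgeModel_holds hX 1).endAlg := by
  haveI := BettiUniverse.finite hX 1
  letI : LieRing (Module.End ℚ (bettiCohomology X.X 1)) := LieRing.ofAssociativeRing
  intro 𝔏 h𝔏 r hr
  obtain ⟨ψ⟩ := BettiUniverse.hodge_isPolarizable exists_isReal_hodgeModel_holds hX 1
  exact radical_le_inf_endAlg_of_eq_hodgeLie _ (by simp) (BettiUniverse.hodge_isEffective _ hX 1) ψ 𝔏 h𝔏 r hr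

/-- **DELIGNE I 3.6 for `H¹X`, Lie form: the Mumford–Tate Lie algebra `𝔪𝔱(H¹X)` is reductive** — for every complex abelian
variety `X` and every Lie subalgebra `𝔏 ≤ 𝔤𝔩(H¹X)` (commutator bracket) with carrier `mumfordTateLieAlgebra (H¹X)`:
`LieAlgebra.HasCentralRadical ℚ 𝔏` (`rad 𝔏 = Z(𝔏)`). [cite: Deligne1982HodgeCycles, I §3 Prop. 3.6] -/
theorem hasCentralRadical_of_eq_mumfordTateLieAlgebra_hodge_one (hX : IsSmoothProjective n X.X) :
    haveI := BettiUniverse.finite hX 1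
    letI : LieRing (Module.End ℚ (bettiCohomology X.X 1)) := LieRing.ofAssociativeRing
    ∀ 𝔏 : LieSubalgebra ℚ (Module.End ℚ (bettiCohomology X.X 1)),
      𝔏.toSubmodule = (BettiUniverse.hodge exists_isReal_hodgeModel_holds hX 1).mumfordTateLieAlgebra →
      LieAlgebra.HasCentralRadical ℚ 𝔏 := by
  haveI := BettiUniverse.finite hX 1
  letI : LieRing (Module.End ℚ (bettiCohomology X.X 1)) := LieRing.ofAssociativeRing
  intro 𝔏 h𝔏
  obtain ⟨ψ⟩ := BettiUniverse.hodge_isPolarizable exists_isReal_hodgeModel_holds hX 1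
  exact hasCentralRadical_of_eq_mumfordTateLieAlgebra _ (by simp) (BettiUniverse.hodge_isEffective _ hX 1) ψ 𝔏 h𝔏

/-- **`[𝔪𝔱(H¹X), 𝔪𝔱(H¹X)] = [Lie Hg(H¹X), Lie Hg(H¹X)]`**: the semisimple part of the Mumford–Tate Lie algebra is that of the
Hodge Lie algebra (`𝔪𝔱 = Lie Hg ⊕ ℚ·id`). [cite: Deligne1982HodgeCycles, I §3 Prop. 3.6] [cite: MoonenZarhin1999LowDim, §2] -/
theorem mumfordTateLieAlgebra_hodge_one_derived_eq (hX : IsSmoothProjective n X.X) :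
    haveI := BettiUniverse.finite hX 1
    Submodule.span ℚ {B | ∃ X' ∈ (BettiUniverse.hodge exists_isReal_hodgeModel_holds hX 1).mumfordTateLieAlgebra,
        ∃ Y ∈ (BettiUniverse.hodge exists_isReal_hodgeModel_holds hX 1).mumfordTateLieAlgebra, X' * Y - Y * X' = B} =
      Submodule.span ℚ {B | ∃ X' ∈ (BettiUniverse.hodge exists_isReal_hodgeModel_holds hX 1).hodgeLie,
        ∃ Y ∈ (BettiUniverse.hodge exists_isReal_hodgeModel_holds hX 1).hodgeLie, X' * Y - Y * X' = B} := by
  haveI := BettiUniverse.finite hX 1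
  obtain ⟨ψ⟩ := BettiUniverse.hodge_isPolarizable exists_isReal_hodgeModel_holds hX 1
  exact mumfordTateLieAlgebra_derived_eq _ ψ (by simp)

end Summit.HodgeConjecture.CorCM

end
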